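import Literature.NumberTheory.Automorphic.IrreducibleClassesConstituents
import HarnessLib

/-!
# Constituents of an extension `0 → N → ρ → ρ ⁄ N → 0`; irreducible atoms; representations of length two

Generic representation theory continuing ★ `Automorphic/IrreducibleClassesConstituents` (★ `IrrClass.IsConstituentOf`):
* §1 `IsConstituentOf.sub_or_quotient`: for ANY `G`-stable `N ≤ ρ`, a constituent of `ρ` is a constituent of the
  subrepresentation `ρ|_N` (★ `Subrepresentation.toRepresentation`) or of the quotient `ρ ⁄ N` (★ `Subrepresentation.quotientRep`)
  — the Jordan–Hölder ∕ Zassenhaus step: an irreducible subquotient `N₁ ⁄ N₂` of `ρ` either maps injectively to the subquotient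
  `(N₁ + N) ⁄ (N₂ + N)` of `ρ ⁄ N`, or `N₁ ≤ N₂ + N` and then `N₁ ⁄ N₂` is a quotient of `N₁ ∩ N ≤ N`.
* §2 atoms and coatoms: a minimal non-zero subrepresentation is irreducible (`isIrreducible_toRepresentation_of_isAtom`, the twin of ★
  `Subrepresentation.isIrreducible_quotientRep` for coatoms); if the lattice of subrepresentations has no chain
  `⊥ < N₁ < N₂ < ⊤` («length ≤ 2», the shape of ★ `UnitaryGroup.U3PrincipalSeriesLengthLeTwo`) then every `⊥ ≠ N ≠ ⊤` is an atom
  and a coatom.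
* §3 `isConstituentOf_iff_of_isIrreducible`: if `ρ|_N` and `ρ ⁄ N` are irreducible (and `ρ` is smooth, carriers in `Type`) then the
  constituents of `ρ` are EXACTLY the two classes `⟦ρ ⁄ N⟧`, `⟦ρ|_N⟧`.
Standard ([BushnellHenniart2006, §1.1–§2]; [BernsteinZelevinsky1976, §2.1]; [Casselman1995, Cor. 7.1.2 «the length of `I` is at most 2»]);
fully proved; theorems only (no definition, no named fact, no instance).  Written for the T3 «KeysCaseTwo» pay-down of cell
pub/hodgecm-mathlib F0∕P3 (stub S2 `stub_labelledPair_of_reducible`), but automorphic-free.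

## References
[BushnellHenniart2006] C. J. Bushnell, G. Henniart, *The local Langlands conjecture for GL(2)*, §1.1–§2 · [BernsteinZelevinsky1976] §2.1 ·
[Casselman1995] W. Casselman, *Introduction to the theory of admissible representations of p-adic reductive groups* (draft 1995), §7.1.
-/

set_option autoImplicit false

noncomputable section

open scoped MonoidAlgebra
open Literature.RepresentationTheory.FiniteGroups Literature.RepresentationTheory.Semisimple

namespace Literature.NumberTheory.Automorphic

namespace IrrClass

universe u

variable {G : Type u} [Group G] [TopologicalSpace G]

/-! ## §1 Constituents of an extension -/

/-- **A constituent of `ρ` is a constituent of `ρ|_N` or of `ρ ⁄ N`** (any `G`-stable `N`).  For an irreducible subquotient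
`N₁ ⁄ N₂ ≅ r` of `ρ`: the `G`-map `N₁ ⁄ N₂ → (ρ ⁄ N) ⁄ \overline{N₂}` (`\overline{N₂}` the image of `N₂`) is injective — then `r`
occurs in a quotient of `ρ ⁄ N` — or zero — then `N₁ ≤ N₂ + N` and `w ↦ [w]` maps `N₁ ∩ N ≤ ρ|_N` ONTO `N₁ ⁄ N₂`.
[cite: BushnellHenniart2006, §2] [cite: BernsteinZelevinsky1976, §2.1] -/
theorem IsConstituentOf.sub_or_quotient {V : Type*} [AddCommGroup V] [Module ℂ V] {ρ : Representation ℂ G V}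
    {c : IrrClass G} (h : c.IsConstituentOf ρ) (N : Subrepresentation ρ) :
    c.IsConstituentOf N.toRepresentation ∨ c.IsConstituentOf N.quotientRep := by
  obtain ⟨r, rfl, N₁, N₂, hle, ⟨e⟩⟩ := h
  -- the subquotient `N₁ ⁄ N₂` as the quotient of `ρ|_{N₁}` by `P = N₂ ∩ N₁`
  set P : Submodule ℂ ↥N₁.toSubmodule := N₂.toSubmodule.comap N₁.toSubmodule.subtype with hPdef
  have hP : ∀ g, P ≤ P.comap (N₁.toRepresentation g) := fun g _ hx ↦ N₂.apply_mem_toSubmodule g hx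
  -- the image `Q₂` of `N₂` in `ρ ⁄ N`, a subrepresentation
  let Q₂ : Subrepresentation N.quotientRep :=
    ⟨N₂.toSubmodule.map N.toSubmodule.mkQ, fun g v hv => by
      obtain ⟨x, hx, rfl⟩ := hv
      exact ⟨ρ g x, N₂.apply_mem_toSubmodule g hx, rfl⟩⟩
  -- `ζ : N₁ ⁄ N₂ → (ρ ⁄ N) ⁄ Q₂`, `[y] ↦ [[y]]`
  let ζ₀ : ↥N₁.toSubmodule →ₗ[ℂ] (V ⧸ N.toSubmodule) ⧸ Q₂.toSubmodule :=
    Q₂.toSubmodule.mkQ ∘ₗ (N.toSubmodule.mkQ ∘ₗ N₁.toSubmodule.subtype)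
  have hζ₀ : P ≤ LinearMap.ker ζ₀ := by
    intro y hy
    rw [LinearMap.mem_ker]
    change Submodule.Quotient.mk (Submodule.Quotient.mk (y : V)) = (0 : (V ⧸ N.toSubmodule) ⧸ Q₂.toSubmodule)
    exact (Submodule.Quotient.mk_eq_zero _).2 ⟨(y : V), hy, rfl⟩
  let ζ : (N₁.toRepresentation.quotient P hP).IntertwiningMap Q₂.quotientRep :=
    { toLinearMap := P.liftQ ζ₀ hζ₀
      isIntertwining' := fun g => by
        refine Submodule.linearMap_qext _ (LinearMap.ext fun y => ?_)
        rfl }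
  have hζ : ∀ y : ↥N₁.toSubmodule,
      ζ (Submodule.Quotient.mk y) = Submodule.Quotient.mk (Submodule.Quotient.mk (y : V)) := fun y => rfl
  -- compose with `e : r ≅ N₁ ⁄ N₂`; an irreducible source makes it injective or zero
  rcases Representation.IsIrreducible.injective_or_eq_zero (ζ.comp e.toIntertwiningMap) with hinj | hzero
  · -- injective: `r` occurs in the quotient `(ρ ⁄ N) ⁄ Q₂`
    right
    have h1 : (IrrClass.mk { V := r.V, ρ := r.ρ, isIrreducible := r.isIrreducible, isSmooth := r.isSmooth }).IsConstituentOf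
        Q₂.quotientRep :=
      isConstituentOf_mk_of_injective r.isIrreducible r.isSmooth (ζ.comp e.toIntertwiningMap) hinj
    exact h1.of_quotientRep Q₂
  · -- zero: `N₁ ≤ N₂ + N`
    left
    have hmem : ∀ y : ↥N₁.toSubmodule, ∃ u : V, u ∈ N₂.toSubmodule ∧ (y : V) - u ∈ N.toSubmodule := by
      intro y
      have h0 : ζ (e (e.symm (Submodule.Quotient.mk y))) = 0 :=
        DFunLike.congr_fun hzero (e.symm (Submodule.Quotient.mk y))
      rw [Representation.Equiv.apply_symm_apply, hζ, Submodule.Quotient.mk_eq_zero] at h0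
      obtain ⟨u, hu, hu'⟩ := h0
      refine ⟨u, hu, ?_⟩
      rw [← Submodule.Quotient.mk_eq_zero, Submodule.Quotient.mk_sub]
      exact sub_eq_zero.2 (Eq.symm hu')
    -- the subrepresentation `W = N₁ ∩ N` of `ρ|_N`
    let W : Subrepresentation N.toRepresentation :=
      ⟨N₁.toSubmodule.comap N.toSubmodule.subtype, fun g w hw => N₁.apply_mem_toSubmodule g hw⟩
    -- `δ : W → N₁ ⁄ N₂`, `w ↦ [w]`
    let ι : ↥W.toSubmodule →ₗ[ℂ] ↥N₁.toSubmodule :=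
      LinearMap.codRestrict N₁.toSubmodule (N.toSubmodule.subtype ∘ₗ W.toSubmodule.subtype) fun w => w.2
    have hι : ∀ w : ↥W.toSubmodule, ((ι w : ↥N₁.toSubmodule) : V) = ((w : ↥N.toSubmodule) : V) := fun w => rfl
    let δ : W.toRepresentation.IntertwiningMap (N₁.toRepresentation.quotient P hP) :=
      { toLinearMap := P.mkQ ∘ₗ ι
        isIntertwining' := fun g => by
          refine LinearMap.ext fun w => ?_
          simp only [LinearMap.coe_comp, Function.comp_apply, Submodule.mkQ_apply, Representation.quotient_apply,
            Submodule.mapQ_apply]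
          exact congrArg Submodule.Quotient.mk (Subtype.ext rfl) }
    have hδ : ∀ w : ↥W.toSubmodule, δ w = Submodule.Quotient.mk (ι w) := fun w => rfl
    have hsurj : Function.Surjective δ := by
      intro q
      obtain ⟨y, rfl⟩ := Submodule.Quotient.mk_surjective P q
      obtain ⟨u, hu, hyu⟩ := hmem y
      have huN₁ : u ∈ N₁.toSubmodule := hle hu
      have hyuN₁ : (y : V) - u ∈ N₁.toSubmodule := N₁.toSubmodule.sub_mem y.2 huN₁
      refine ⟨⟨⟨(y : V) - u, hyu⟩, hyuN₁⟩, ?_⟩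
      rw [hδ]
      have hι' : ι ⟨⟨(y : V) - u, hyu⟩, hyuN₁⟩ = y - ⟨u, huN₁⟩ := Subtype.ext (by rw [hι]; rfl)
      rw [hι', Submodule.Quotient.mk_sub, sub_eq_self, Submodule.Quotient.mk_eq_zero]
      exact hu
    have h1 : (IrrClass.mk r).IsConstituentOf (N₁.toRepresentation.quotient P hP) :=
      (isConstituentOf_congr e (IrrClass.mk r)).1 (isConstituentOf_mk_self r)
    exact (h1.of_surjective δ hsurj).of_subrepresentation W

/-! ## §2 Atoms, coatoms, and lattices without `3`-chains -/

omit [TopologicalSpace G] in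
/-- **A minimal non-zero subrepresentation is irreducible**: if `N` is an atom of the lattice of subrepresentations of `ρ` then
`ρ|_N` is irreducible (through the `ℂ[G]`-module dictionary: ★ `Subrepresentation.asModuleEquiv`, Mathlib
`isSimpleModule_iff_isAtom`). [cite: BushnellHenniart2006, §1.1] [cite: BernsteinZelevinsky1976, §2.1] -/
theorem isIrreducible_toRepresentation_of_isAtom {V : Type*} [AddCommGroup V] [Module ℂ V] {ρ : Representation ℂ G V}
    {N : Subrepresentation ρ} (hN : IsAtom N) : N.toRepresentation.IsIrreducible := by
  have h1 : IsAtom N.asSubmodule :=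
    ((Subrepresentation.subrepresentationSubmoduleOrderIso (ρ := ρ)).isAtom_iff N).2 hN
  haveI : IsSimpleModule ℂ[G] ↥N.asSubmodule := isSimpleModule_iff_isAtom.2 h1
  haveI : IsSimpleModule ℂ[G] N.toRepresentation.asModule := IsSimpleModule.congr (Subrepresentation.asModuleEquiv N)
  exact (Representation.irreducible_iff_isSimpleModule_asModule _).2 this

omit [TopologicalSpace G] in
/-- In a lattice of subrepresentations WITHOUT `3`-chains `⊥ < N₁ < N₂ < ⊤` («length at most two»), every `N` with `⊥ ≠ N`,
`N ≠ ⊤` is an ATOM. [cite: Casselman1995, Cor. 7.1.2] -/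
theorem isAtom_of_forall_not_lt_lt {V : Type*} [AddCommGroup V] [Module ℂ V] {ρ : Representation ℂ G V}
    (hlen : ∀ N₁ N₂ : Subrepresentation ρ, ¬ (⊥ < N₁ ∧ N₁ < N₂ ∧ N₂ < ⊤)) {N : Subrepresentation ρ} (hb : N ≠ ⊥)
    (ht : N ≠ ⊤) : IsAtom N := by
  refine ⟨hb, fun M hM => ?_⟩
  by_contra hMb
  exact hlen M N ⟨bot_lt_iff_ne_bot.2 hMb, hM, lt_top_iff_ne_top.2 ht⟩

omit [TopologicalSpace G] in
/-- … and a COATOM. [cite: Casselman1995, Cor. 7.1.2] -/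
theorem isCoatom_of_forall_not_lt_lt {V : Type*} [AddCommGroup V] [Module ℂ V] {ρ : Representation ℂ G V}
    (hlen : ∀ N₁ N₂ : Subrepresentation ρ, ¬ (⊥ < N₁ ∧ N₁ < N₂ ∧ N₂ < ⊤)) {N : Subrepresentation ρ} (hb : N ≠ ⊥)
    (ht : N ≠ ⊤) : IsCoatom N := by
  refine ⟨ht, fun M hM => ?_⟩
  by_contra hMt
  exact hlen N M ⟨bot_lt_iff_ne_bot.2 hb, hM, lt_top_iff_ne_top.2 hMt⟩

omit [TopologicalSpace G] in
/-- Without `3`-chains, `ρ|_N` is irreducible for every `⊥ ≠ N ≠ ⊤`. [cite: Casselman1995, Cor. 7.1.2] [cite: BushnellHenniart2006, §1.1] -/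
theorem isIrreducible_toRepresentation_of_forall_not_lt_lt {V : Type*} [AddCommGroup V] [Module ℂ V]
    {ρ : Representation ℂ G V} (hlen : ∀ N₁ N₂ : Subrepresentation ρ, ¬ (⊥ < N₁ ∧ N₁ < N₂ ∧ N₂ < ⊤))
    {N : Subrepresentation ρ} (hb : N ≠ ⊥) (ht : N ≠ ⊤) : N.toRepresentation.IsIrreducible :=
  isIrreducible_toRepresentation_of_isAtom (isAtom_of_forall_not_lt_lt hlen hb ht)

omit [TopologicalSpace G] in
/-- Without `3`-chains, `ρ ⁄ N` is irreducible for every `⊥ ≠ N ≠ ⊤` (★ `Subrepresentation.isIrreducible_quotientRep`).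
[cite: Casselman1995, Cor. 7.1.2] [cite: BushnellHenniart2006, §1.1] -/
theorem isIrreducible_quotientRep_of_forall_not_lt_lt {V : Type*} [AddCommGroup V] [Module ℂ V]
    {ρ : Representation ℂ G V} (hlen : ∀ N₁ N₂ : Subrepresentation ρ, ¬ (⊥ < N₁ ∧ N₁ < N₂ ∧ N₂ < ⊤))
    {N : Subrepresentation ρ} (hb : N ≠ ⊥) (ht : N ≠ ⊤) : N.quotientRep.IsIrreducible :=
  Subrepresentation.isIrreducible_quotientRep (isCoatom_of_forall_not_lt_lt hlen hb ht)

/-! ## §3 The constituents of a representation with irreducible `ρ|_N` and `ρ ⁄ N` -/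

/-- **If `ρ|_N` and `ρ ⁄ N` are irreducible, the constituents of the smooth `ρ` are EXACTLY `⟦ρ ⁄ N⟧` and `⟦ρ|_N⟧`**
(§1 + ★ `isConstituentOf_iff_eq_mk`). [cite: BushnellHenniart2006, §2] [cite: Casselman1995, §7.1] -/
theorem isConstituentOf_iff_of_isIrreducible [SeparatelyContinuousMul G] {V : Type} [AddCommGroup V] [Module ℂ V]
    {ρ : Representation ℂ G V} (hρ : ρ.IsSmooth) (N : Subrepresentation ρ) (hN : N.toRepresentation.IsIrreducible)
    (hQ : N.quotientRep.IsIrreducible) (c : IrrClass G) :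
    c.IsConstituentOf ρ ↔
      c = IrrClass.mk (SmoothIrrep.mk (V ⧸ N.toSubmodule) N.quotientRep hQ (hρ.quotientRep N)) ∨
        c = IrrClass.mk (SmoothIrrep.mk ↥N.toSubmodule N.toRepresentation hN (hρ.toRepresentation N)) := by
  constructor
  · intro h
    rcases h.sub_or_quotient N with hs | hq
    · exact Or.inr ((isConstituentOf_iff_eq_mk _ hN (hρ.toRepresentation N) c).1 hs)
    · exact Or.inl ((isConstituentOf_iff_eq_mk _ hQ (hρ.quotientRep N) c).1 hq)
  · rintro (rfl | rfl)
    · exact (isConstituentOf_mk_self _).of_quotientRep N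
    · exact (isConstituentOf_mk_self _).of_subrepresentation N

end IrrClass

end Literature.NumberTheory.Automorphic

end
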